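import Literature.AlgebraicGeometry.Milne1999.HodgeGroupPowersProductsMulEquiv
import Literature.AlgebraicGeometry.Milne1999.LefschetzCentraliserBiproducts
import HarnessLib

/-!
# `Hg(X × X₁^{n₁} × ⋯ × X_r^{n_r}) ≅ Hg(X × X₁ × ⋯ × X_r)` and `Hg(X₁^{n₁} × ⋯ × X_r^{n_r}) ≅ Hg(X₁ × ⋯ × X_r)` for EVERY `r` (Moonen–Zarhin 1999, §1, second sentence, in full — Tannaka-free, on the real carriers), with the semisimplicity of `Hg` along

Family `hodge`, layer `Literature/AlgebraicGeometry/Milne1999`, namespace `Literature.AlgebraicGeometry.Milne1999` (D-0022).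
THEOREMS ONLY (no definition, no named fact, no `sorry`; net debt 0). Sequel of `Milne1999/HodgeGroupPowersProductsMulEquiv`
(`Hg(B × C)(ℂ) ≅ Hg(B^{m+1} × C^{n+1})(ℂ)`, `Hg(A) ≅ Hg(B)` for `A ∼ B`, semisimplicity transport) and of
`Milne1999/HodgeGroupProductsPowers`, both of which list «`r ≥ 3` factors (iterate)» under "What is NOT here"; written by the
`lit-hodgefound` prover seat p21 (generation 35, row #6), the `Hg` companion of the seat's `LefschetzGroupFiniteProductsPowers`
(same induction; here the groups are compared as abstract groups, `Nonempty (_ ≃* _)`, the format of `HodgeGroupPowersProductsMulEquiv`).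

## Source, verbatim (held text `paper:arxiv-math_9901113` = B. Moonen, Yu. G. Zarhin, *Hodge classes on abelian varieties of low
dimension*, Math. Ann. 315 (1999) 711–733, chunk p0002 L137–L141, re-read)

§1: «For `n ≥ 1` we can identify `Hg(Xⁿ)` with `Hg(X)`, acting diagonally on `V_{Xⁿ} = (V_X)ⁿ`. More generally, if `n_1, …, n_r ∈ ℤ_{≥1}`
then we can identify `Hg(X_1^{n_1} × ⋯ × X_r^{n_r})` with `Hg(X_1 × ⋯ × X_r)`.»

## The objects (all pre-existing in the tree; nothing is defined here)

`Hg(Y)(ℂ) = HodgeTheory.hodgeGroup (dim Y) Y.X` (Tannaka-free: Künneth families on the powers of `Y.X` fixing the rational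
`(p,p)`-classes; `HodgeTheory/MotivatedGaloisGroup`), `HasSemisimpleHodgeGroup Y` (finite centre of `Hg(Y)(ℂ)`, Gordon 1.3),
`Y^{r+1} = Y.powSucc r`, `×` = `AbelianVariety.prod`, `⨁` the finite biproduct with its comparison isogenies `biproductSuccSplit` /
`biproductSuccSplitInv` (`Milne1999/LefschetzCentraliserBiproducts`).

## What is proved

* §1 **PASSENGER FORM** `nonempty_hodgeGroup_prod_biproduct_mulEquiv_prod_biproduct_powSucc`: for every `X`, every finite family
  `A : Fin n → AbelianVariety ℂ` and exponents `r`, `Hg(X × ⨁ᵢ Aᵢ)(ℂ) ≅ Hg(X × ⨁ᵢ Aᵢ^{rᵢ+1})(ℂ)`. Induction on `n`: split off `A₀`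
  (`biproductSuccSplit`), rotate it to the right of the passenger `X × ⨁ A_{i+1}` (reassociation / swap isomorphisms, §0), reduce its
  exponent by the two-factor theorem with `m = 0` (`nonempty_hodgeGroup_prod_mulEquiv_powSucc_prod_powSucc`), rotate `A₀^{r₀+1}` into
  the passenger, apply the induction hypothesis, reassociate and reassemble; isogenies act by `nonempty_hodgeGroup_mulEquiv_of_isIsogenous`.
  With it: `hasSemisimpleHodgeGroup_prod_biproduct_powSucc_iff`.
* §2 **NO PASSENGER**: `nonempty_hodgeGroup_biproduct_mulEquiv_biproduct_powSucc` (`Hg(⨁ᵢ Aᵢ) ≅ Hg(⨁ᵢ Aᵢ^{rᵢ+1})`, families on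
  `Fin (n+1)`) — Moonen–Zarhin's sentence for every `r` —, `hasSemisimpleHodgeGroup_biproduct_powSucc_iff`, and the same for every
  `Y ∼ ⨁ᵢ Aᵢ^{rᵢ+1}` (`nonempty_hodgeGroup_mulEquiv_of_isIsogenous_biproduct_powSucc`, `hasSemisimpleHodgeGroup_iff_of_isIsogenous_biproduct_powSucc`).
* §3 **THREE FACTORS, BIPRODUCT-FREE**: `Hg((A^{a+1} × B^{b+1}) × C^{c+1}) ≅ Hg((A × B) × C)` and the semisimplicity equivalence.

## What is NOT here (honest column)

Explicit formulas (the isomorphisms are block-diagonal with diagonal blocks factor by factor, `mem_hodgeGroup_powSucc_prod_powSucc_iff`;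
only `Nonempty` is recorded, as in the prequel); the Mumford–Tate group `MT` (its two-factor isomorphism is not in the tree in this
format); splitting criteria (3.1) for `r ≥ 3` factors; the `L` / `ker l` versions WITH the character are the seat's
`LefschetzGroupFiniteProductsPowers`. PRESEARCH (2026-08-28): corpus `paper:arxiv-math_9901113` §1 re-read (quote above); tree:
`rg 'hodgeGroup.*biproduct|biproduct.*hodgeGroup'` — `LefschetzGroupIsotypicProducts` (`nonempty_hodgeGroup_biproduct_mulEquiv_of_forall`,
ONE isogeny type only), `HodgeGroupPowersProductsMulEquiv` (two factors); no statement for a general finite product of powers;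
certification on the carriers, no novelty claimed.

## References

* [MoonenZarhin1999LowDim] B. Moonen, Yu. G. Zarhin, Hodge classes on abelian varieties of low dimension, Math. Ann. 315 (1999)
  711–733: §1.
* [Gordon1999HodgeAVSurvey] B. B. Gordon, A survey of the Hodge conjecture for abelian varieties (1999): 1.3 Definition, 2.1.7, 2.2.
* [Milne1999LefschetzClasses] J. S. Milne, Lefschetz classes on abelian varieties, Duke Math. J. 96 (1999): §1 p. 643.
* [MumfordAV1970] D. Mumford, Abelian Varieties (1970): §19 (products, isogenies).
-/

noncomputable section

open CategoryTheory CategoryTheory.Limits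
open Literature.AlgebraicTopology.SingularHomology
open Literature.AlgebraicGeometry.HodgeTheory
open Literature.AlgebraicGeometry.Motives

namespace Literature.AlgebraicGeometry.Milne1999

/-! ### §0 Plumbing (private): reassociation isogenies, composition of `Nonempty (_ ≃* _)` -/

section Plumbing

/-- `(X × Y) × Z ∼ (X × Z) × Y` (an isomorphism of abelian varieties: swap the last two factors). [cite: MumfordAV1970, §19] -/
private theorem isIsogenous_prod_prod_swap_right (X Y Z : AbelianVariety ℂ) :
    AbelianVariety.IsIsogenous ((X.prod Y).prod Z) ((X.prod Z).prod Y) := by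
  refine ⟨AbelianVariety.prodLift (AbelianVariety.prodLift (AbelianVariety.fst _ _ ≫ AbelianVariety.fst _ _) (AbelianVariety.snd _ _))
      (AbelianVariety.fst _ _ ≫ AbelianVariety.snd _ _),
    AbelianVariety.isIsogeny_of_comp_eq_of_comp_eq
      (h := AbelianVariety.prodLift (AbelianVariety.prodLift (AbelianVariety.fst _ _ ≫ AbelianVariety.fst _ _) (AbelianVariety.snd _ _))
        (AbelianVariety.fst _ _ ≫ AbelianVariety.snd _ _))
      (AbelianVariety.isIsogeny_id _) (AbelianVariety.isIsogeny_id _) ?_ ?_⟩ <;>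
  · refine AbelianVariety.prod_hom_ext (AbelianVariety.prod_hom_ext ?_ ?_) ?_ <;>
      simp only [Category.assoc, Category.id_comp, AbelianVariety.prodLift_fst, AbelianVariety.prodLift_snd,
        AbelianVariety.prodLift_fst_assoc]

/-- `X × Y ∼ Y × X` (the swap, an isomorphism). [cite: MumfordAV1970, §19] -/
private theorem isIsogenous_prod_comm' (X Y : AbelianVariety ℂ) : AbelianVariety.IsIsogenous (X.prod Y) (Y.prod X) := by
  refine ⟨AbelianVariety.prodLift (AbelianVariety.snd _ _) (AbelianVariety.fst _ _),
    AbelianVariety.isIsogeny_of_comp_eq_of_comp_eq (h := AbelianVariety.prodLift (AbelianVariety.snd _ _) (AbelianVariety.fst _ _))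
      (AbelianVariety.isIsogeny_id _) (AbelianVariety.isIsogeny_id _) ?_ ?_⟩ <;>
  · refine AbelianVariety.prod_hom_ext ?_ ?_ <;>
      simp only [Category.assoc, Category.id_comp, AbelianVariety.prodLift_fst, AbelianVariety.prodLift_snd]

/-- `X × (Y × Z) ∼ (X × Y) × Z` (reassociation, an isomorphism). [cite: MumfordAV1970, §19] -/
private theorem isIsogenous_prod_assoc_symm (X Y Z : AbelianVariety ℂ) :
    AbelianVariety.IsIsogenous (X.prod (Y.prod Z)) ((X.prod Y).prod Z) := by
  refine ⟨AbelianVariety.prodLift (AbelianVariety.prodLift (AbelianVariety.fst _ _) (AbelianVariety.snd _ _ ≫ AbelianVariety.fst _ _))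
      (AbelianVariety.snd _ _ ≫ AbelianVariety.snd _ _),
    AbelianVariety.isIsogeny_of_comp_eq_of_comp_eq
      (h := AbelianVariety.prodLift (AbelianVariety.fst _ _ ≫ AbelianVariety.fst _ _)
        (AbelianVariety.prodLift (AbelianVariety.fst _ _ ≫ AbelianVariety.snd _ _) (AbelianVariety.snd _ _)))
      (AbelianVariety.isIsogeny_id _) (AbelianVariety.isIsogeny_id _) ?_ ?_⟩
  · refine AbelianVariety.prod_hom_ext (AbelianVariety.prod_hom_ext ?_ ?_) ?_ <;>
      simp only [Category.assoc, Category.id_comp, AbelianVariety.prodLift_fst, AbelianVariety.prodLift_snd,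
        AbelianVariety.prodLift_snd_assoc]
  · refine AbelianVariety.prod_hom_ext ?_ (AbelianVariety.prod_hom_ext ?_ ?_) <;>
      simp only [Category.assoc, Category.id_comp, AbelianVariety.prodLift_fst, AbelianVariety.prodLift_snd,
        AbelianVariety.prodLift_fst_assoc]

/-- `(X × Y) × Z ∼ X × (Y × Z)` (reassociation, an isomorphism). [cite: MumfordAV1970, §19] -/
private theorem isIsogenous_prod_assoc' (X Y Z : AbelianVariety ℂ) :
    AbelianVariety.IsIsogenous ((X.prod Y).prod Z) (X.prod (Y.prod Z)) := by
  refine ⟨AbelianVariety.prodLift (AbelianVariety.fst _ _ ≫ AbelianVariety.fst _ _)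
      (AbelianVariety.prodLift (AbelianVariety.fst _ _ ≫ AbelianVariety.snd _ _) (AbelianVariety.snd _ _)),
    AbelianVariety.isIsogeny_of_comp_eq_of_comp_eq
      (h := AbelianVariety.prodLift (AbelianVariety.prodLift (AbelianVariety.fst _ _) (AbelianVariety.snd _ _ ≫ AbelianVariety.fst _ _))
        (AbelianVariety.snd _ _ ≫ AbelianVariety.snd _ _))
      (AbelianVariety.isIsogeny_id _) (AbelianVariety.isIsogeny_id _) ?_ ?_⟩
  · refine AbelianVariety.prod_hom_ext ?_ (AbelianVariety.prod_hom_ext ?_ ?_) <;>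
      simp only [Category.assoc, Category.id_comp, AbelianVariety.prodLift_fst, AbelianVariety.prodLift_snd,
        AbelianVariety.prodLift_fst_assoc]
  · refine AbelianVariety.prod_hom_ext (AbelianVariety.prod_hom_ext ?_ ?_) ?_ <;>
      simp only [Category.assoc, Category.id_comp, AbelianVariety.prodLift_fst, AbelianVariety.prodLift_snd,
        AbelianVariety.prodLift_snd_assoc]

/-- Composition of `Nonempty (_ ≃* _)` along `Hg`. [folklore] -/
private theorem nonempty_trans {X Y Z : AbelianVariety ℂ} (h₁ : Nonempty (hodgeGroup X.dim X.X ≃* hodgeGroup Y.dim Y.X))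
    (h₂ : Nonempty (hodgeGroup Y.dim Y.X ≃* hodgeGroup Z.dim Z.X)) : Nonempty (hodgeGroup X.dim X.X ≃* hodgeGroup Z.dim Z.X) := by
  obtain ⟨e₁⟩ := h₁
  obtain ⟨e₂⟩ := h₂
  exact ⟨e₁.trans e₂⟩

end Plumbing

/-! ### §1 The passenger form: `Hg(X × ⨁ᵢ Aᵢ)(ℂ) ≅ Hg(X × ⨁ᵢ Aᵢ^{rᵢ+1})(ℂ)` -/

section Passenger

/-- **`Hg(X × ⨁ᵢ Aᵢ)(ℂ) ≅ Hg(X × ⨁ᵢ Aᵢ^{rᵢ+1})(ℂ)` FOR EVERY PASSENGER `X`, EVERY FINITE FAMILY `(Aᵢ)` AND ALL EXPONENTS** («we can identify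
`Hg(X_1^{n_1} × ⋯ × X_r^{n_r})` with `Hg(X_1 × ⋯ × X_r)`», Tannaka-free carriers, no hypothesis on the factors). Induction on the number of
factors: split off `A₀` (`biproductSuccSplit`), rotate it to the right of the passenger, reduce its exponent by the two-factor theorem with
`m = 0`, rotate `A₀^{r₀+1}` into the passenger, apply the induction hypothesis to `(A_{i+1})ᵢ`, reassociate and reassemble
(`biproductSuccSplitInv`). [cite: MoonenZarhin1999LowDim, §1] [cite: Milne1999LefschetzClasses, §1 p. 643] -/
theorem nonempty_hodgeGroup_prod_biproduct_mulEquiv_prod_biproduct_powSucc :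
    ∀ {n : ℕ} (X : AbelianVariety ℂ) (A : Fin n → AbelianVariety ℂ) (r : Fin n → ℕ),
      Nonempty (hodgeGroup (X.prod (⨁ A)).dim (X.prod (⨁ A)).X ≃*
        hodgeGroup (X.prod (⨁ fun i ↦ (A i).powSucc (r i))).dim (X.prod (⨁ fun i ↦ (A i).powSucc (r i))).X)
  | 0, X, A, r => by
    -- over `Fin 0` the two families coincide
    suffices h : ∀ F F' : Fin 0 → AbelianVariety ℂ,
        Nonempty (hodgeGroup (X.prod (⨁ F)).dim (X.prod (⨁ F)).X ≃* hodgeGroup (X.prod (⨁ F')).dim (X.prod (⨁ F')).X) from h _ _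
    intro F F'
    obtain rfl : F = F' := funext fun i ↦ i.elim0
    exact ⟨MulEquiv.refl _⟩
  | n + 1, X, A, r => by
    -- `X × ⨁ A ∼ X × (A₀ × T) ∼ (X × T) × A₀`, `T = ⨁ᵢ A_{i+1}`
    have h01 : AbelianVariety.IsIsogenous (X.prod (⨁ A)) (X.prod ((A 0).prod (⨁ fun i : Fin n ↦ A i.succ))) :=
      ⟨_, AbelianVariety.isIsogeny_prodMap (AbelianVariety.isIsogeny_id X) (isIsogeny_biproductSuccSplit A)⟩
    have h12 : AbelianVariety.IsIsogenous (X.prod ((A 0).prod (⨁ fun i : Fin n ↦ A i.succ)))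
        ((X.prod (⨁ fun i : Fin n ↦ A i.succ)).prod (A 0)) :=
      (isIsogenous_prod_assoc_symm X (A 0) _).trans (isIsogenous_prod_prod_swap_right X (A 0) _)
    -- reduce the exponent of `A₀` with the passenger `X × T` (two-factor theorem, `m = 0`)
    have h23 := nonempty_hodgeGroup_prod_mulEquiv_powSucc_prod_powSucc (X.prod (⨁ fun i : Fin n ↦ A i.succ)) (A 0) 0 (r 0)
    -- `(X × T) × A₀^{r₀+1} ∼ (X × A₀^{r₀+1}) × T`
    have h34 : AbelianVariety.IsIsogenous (((X.prod (⨁ fun i : Fin n ↦ A i.succ)).powSucc 0).prod ((A 0).powSucc (r 0)))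
        ((X.prod ((A 0).powSucc (r 0))).prod (⨁ fun i : Fin n ↦ A i.succ)) :=
      isIsogenous_prod_prod_swap_right X (⨁ fun i : Fin n ↦ A i.succ) ((A 0).powSucc (r 0))
    -- the induction hypothesis, passenger `X × A₀^{r₀+1}`, family `(A_{i+1})ᵢ`
    have hIH := nonempty_hodgeGroup_prod_biproduct_mulEquiv_prod_biproduct_powSucc (X.prod ((A 0).powSucc (r 0)))
      (fun i : Fin n ↦ A i.succ) (fun i ↦ r i.succ)
    -- `(X × A₀^{r₀+1}) × ⨁ᵢ A_{i+1}^{r_{i+1}+1} ∼ X × (A₀^{r₀+1} × ⨁ᵢ A_{i+1}^{r_{i+1}+1}) ∼ X × ⨁ᵢ Aᵢ^{rᵢ+1}`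
    have h56 : AbelianVariety.IsIsogenous
        ((X.prod ((A 0).powSucc (r 0))).prod (⨁ fun i : Fin n ↦ (A i.succ).powSucc (r i.succ)))
        (X.prod (((A 0).powSucc (r 0)).prod (⨁ fun i : Fin n ↦ (A i.succ).powSucc (r i.succ)))) :=
      isIsogenous_prod_assoc' X _ _
    have h67 : AbelianVariety.IsIsogenous
        (X.prod (((A 0).powSucc (r 0)).prod (⨁ fun i : Fin n ↦ (A i.succ).powSucc (r i.succ))))
        (X.prod (⨁ fun i ↦ (A i).powSucc (r i))) :=
      ⟨_, AbelianVariety.isIsogeny_prodMap (AbelianVariety.isIsogeny_id X)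
        (isIsogeny_biproductSuccSplitInv (fun i ↦ (A i).powSucc (r i)))⟩
    exact nonempty_trans (nonempty_hodgeGroup_mulEquiv_of_isIsogenous h01)
      (nonempty_trans (nonempty_hodgeGroup_mulEquiv_of_isIsogenous h12) (nonempty_trans h23
        (nonempty_trans (nonempty_hodgeGroup_mulEquiv_of_isIsogenous h34) (nonempty_trans hIH
          (nonempty_trans (nonempty_hodgeGroup_mulEquiv_of_isIsogenous h56) (nonempty_hodgeGroup_mulEquiv_of_isIsogenous h67))))))

/-- **`Hg(X × ⨁ᵢ Aᵢ^{rᵢ+1})` is semisimple iff `Hg(X × ⨁ᵢ Aᵢ)` is** (finite centre on the carriers; passenger form).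
[cite: MoonenZarhin1999LowDim, §1] [cite: Gordon1999HodgeAVSurvey, 1.3 Definition] -/
theorem hasSemisimpleHodgeGroup_prod_biproduct_powSucc_iff {n : ℕ} (X : AbelianVariety ℂ) (A : Fin n → AbelianVariety ℂ)
    (r : Fin n → ℕ) :
    HasSemisimpleHodgeGroup (X.prod (⨁ fun i ↦ (A i).powSucc (r i))) ↔ HasSemisimpleHodgeGroup (X.prod (⨁ A)) := by
  obtain ⟨e⟩ := nonempty_hodgeGroup_prod_biproduct_mulEquiv_prod_biproduct_powSucc X A r
  exact (hasSemisimpleHodgeGroup_iff_of_mulEquiv e).symm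

end Passenger

/-! ### §2 No passenger: `Hg(⨁ᵢ Aᵢ)(ℂ) ≅ Hg(⨁ᵢ Aᵢ^{rᵢ+1})(ℂ)` — Moonen–Zarhin §1, second sentence, for every `r` -/

section NoPassenger

/-- **MOONEN–ZARHIN §1, SECOND SENTENCE, FOR EVERY `r`: `Hg(⨁ᵢ Aᵢ)(ℂ) ≅ Hg(⨁ᵢ Aᵢ^{rᵢ+1})(ℂ)`** for every finite family
`A : Fin (n+1) → AbelianVariety ℂ` and all exponents, NO hypothesis on the factors («if `n_1, …, n_r ∈ ℤ_{≥1}` then we can identify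
`Hg(X_1^{n_1} × ⋯ × X_r^{n_r})` with `Hg(X_1 × ⋯ × X_r)`»). Split off `A₀`, §1 with passenger `A₀`, the two-factor theorem for
`A₀ × ⨁ᵢ A_{i+1}^{r_{i+1}+1}` (`n = 0`), reassemble. [cite: MoonenZarhin1999LowDim, §1] [cite: Milne1999LefschetzClasses, §1 p. 643] -/
theorem nonempty_hodgeGroup_biproduct_mulEquiv_biproduct_powSucc {n : ℕ} (A : Fin (n + 1) → AbelianVariety ℂ) (r : Fin (n + 1) → ℕ) :
    Nonempty (hodgeGroup (⨁ A).dim (⨁ A).X ≃* hodgeGroup (⨁ fun i ↦ (A i).powSucc (r i)).dim (⨁ fun i ↦ (A i).powSucc (r i)).X) := by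
  have h01 : AbelianVariety.IsIsogenous (⨁ A) ((A 0).prod (⨁ fun i : Fin n ↦ A i.succ)) := ⟨_, isIsogeny_biproductSuccSplit A⟩
  have h12 := nonempty_hodgeGroup_prod_biproduct_mulEquiv_prod_biproduct_powSucc (A 0) (fun i : Fin n ↦ A i.succ)
    (fun i ↦ r i.succ)
  have h23 := nonempty_hodgeGroup_prod_mulEquiv_powSucc_prod_powSucc (A 0)
    (⨁ fun i : Fin n ↦ (A i.succ).powSucc (r i.succ)) (r 0) 0
  have h34 : AbelianVariety.IsIsogenous
      (((A 0).powSucc (r 0)).prod ((⨁ fun i : Fin n ↦ (A i.succ).powSucc (r i.succ)).powSucc 0))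
      (⨁ fun i ↦ (A i).powSucc (r i)) :=
    ⟨_, isIsogeny_biproductSuccSplitInv (fun i ↦ (A i).powSucc (r i))⟩
  exact nonempty_trans (nonempty_hodgeGroup_mulEquiv_of_isIsogenous h01) (nonempty_trans h12 (nonempty_trans h23
    (nonempty_hodgeGroup_mulEquiv_of_isIsogenous h34)))

/-- **`Hg(⨁ᵢ Aᵢ^{rᵢ+1})` is semisimple iff `Hg(⨁ᵢ Aᵢ)` is** (finite centre on the carriers), arbitrary factors.
[cite: MoonenZarhin1999LowDim, §1] [cite: Gordon1999HodgeAVSurvey, 1.3 Definition] -/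
theorem hasSemisimpleHodgeGroup_biproduct_powSucc_iff {n : ℕ} (A : Fin (n + 1) → AbelianVariety ℂ) (r : Fin (n + 1) → ℕ) :
    HasSemisimpleHodgeGroup (⨁ fun i ↦ (A i).powSucc (r i)) ↔ HasSemisimpleHodgeGroup (⨁ A) := by
  obtain ⟨e⟩ := nonempty_hodgeGroup_biproduct_mulEquiv_biproduct_powSucc A r
  exact (hasSemisimpleHodgeGroup_iff_of_mulEquiv e).symm

/-- **`Hg(Y)(ℂ) ≅ Hg(⨁ᵢ Aᵢ)(ℂ)` for every `Y` isogenous to `⨁ᵢ Aᵢ^{rᵢ+1}`** (Moonen–Zarhin §1 with the isogeny invariance of the Hodge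
group, Gordon 2.1.7/2.2). [cite: MoonenZarhin1999LowDim, §1] [cite: Gordon1999HodgeAVSurvey, 2.1.7 and 2.2] -/
theorem nonempty_hodgeGroup_mulEquiv_of_isIsogenous_biproduct_powSucc {n : ℕ} (A : Fin (n + 1) → AbelianVariety ℂ) (r : Fin (n + 1) → ℕ)
    {Y : AbelianVariety ℂ} (hY : AbelianVariety.IsIsogenous Y (⨁ fun i ↦ (A i).powSucc (r i))) :
    Nonempty (hodgeGroup Y.dim Y.X ≃* hodgeGroup (⨁ A).dim (⨁ A).X) := by
  obtain ⟨e₁⟩ := nonempty_hodgeGroup_mulEquiv_of_isIsogenous hY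
  obtain ⟨e₂⟩ := nonempty_hodgeGroup_biproduct_mulEquiv_biproduct_powSucc A r
  exact ⟨e₁.trans e₂.symm⟩

/-- **Semisimplicity of `Hg` on the isogeny class of a product of powers**: for `Y ∼ ⨁ᵢ Aᵢ^{rᵢ+1}`, `Hg(Y)` is semisimple iff `Hg(⨁ᵢ Aᵢ)` is.
[cite: MoonenZarhin1999LowDim, §1] [cite: Gordon1999HodgeAVSurvey, 1.3 Definition, 2.1.7 and 2.2] -/
theorem hasSemisimpleHodgeGroup_iff_of_isIsogenous_biproduct_powSucc {n : ℕ} (A : Fin (n + 1) → AbelianVariety ℂ)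
    (r : Fin (n + 1) → ℕ) {Y : AbelianVariety ℂ} (hY : AbelianVariety.IsIsogenous Y (⨁ fun i ↦ (A i).powSucc (r i))) :
    HasSemisimpleHodgeGroup Y ↔ HasSemisimpleHodgeGroup (⨁ A) := by
  obtain ⟨e⟩ := nonempty_hodgeGroup_mulEquiv_of_isIsogenous_biproduct_powSucc A r hY
  exact hasSemisimpleHodgeGroup_iff_of_mulEquiv e

/-- **`Hg(Y)(ℂ) ≅ Hg(Z)(ℂ)` whenever `Y ∼ ⨁ᵢ Aᵢ^{rᵢ+1}` and `Z ∼ ⨁ᵢ Aᵢ^{sᵢ+1}`** — two products of powers of the same factors with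
arbitrary exponents have isomorphic Hodge groups. [cite: MoonenZarhin1999LowDim, §1] [cite: Gordon1999HodgeAVSurvey, 2.1.7 and 2.2] -/
theorem nonempty_hodgeGroup_mulEquiv_of_isIsogenous_biproduct_powSucc_of_isIsogenous_biproduct_powSucc {n : ℕ}
    (A : Fin (n + 1) → AbelianVariety ℂ) (r s : Fin (n + 1) → ℕ) {Y Z : AbelianVariety ℂ}
    (hY : AbelianVariety.IsIsogenous Y (⨁ fun i ↦ (A i).powSucc (r i))) (hZ : AbelianVariety.IsIsogenous Z (⨁ fun i ↦ (A i).powSucc (s i))) :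
    Nonempty (hodgeGroup Y.dim Y.X ≃* hodgeGroup Z.dim Z.X) := by
  obtain ⟨e₁⟩ := nonempty_hodgeGroup_mulEquiv_of_isIsogenous_biproduct_powSucc A r hY
  obtain ⟨e₂⟩ := nonempty_hodgeGroup_mulEquiv_of_isIsogenous_biproduct_powSucc A s hZ
  exact ⟨e₁.trans e₂.symm⟩

end NoPassenger

/-! ### §3 Three factors, biproduct-free -/

section ThreeFactors

/-- **`Hg((A × B) × C)(ℂ) ≅ Hg((A^{a+1} × B^{b+1}) × C^{c+1})(ℂ)` for ARBITRARY `A`, `B`, `C`** (Moonen–Zarhin §1 for `r = 3`, in binary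
products): the two-factor theorem three times, each factor in turn rotated to the right of a passenger.
[cite: MoonenZarhin1999LowDim, §1] [cite: Milne1999LefschetzClasses, §1 p. 643] -/
theorem nonempty_hodgeGroup_prod_prod_mulEquiv_powSucc_prod_powSucc_prod_powSucc (A B C : AbelianVariety ℂ) (a b c : ℕ) :
    Nonempty (hodgeGroup ((A.prod B).prod C).dim ((A.prod B).prod C).X ≃*
      hodgeGroup (((A.powSucc a).prod (B.powSucc b)).prod (C.powSucc c)).dim (((A.powSucc a).prod (B.powSucc b)).prod (C.powSucc c)).X) := by
  have h1 := nonempty_hodgeGroup_prod_mulEquiv_powSucc_prod_powSucc (A.prod B) C 0 c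
  have h2 : AbelianVariety.IsIsogenous (((A.prod B).powSucc 0).prod (C.powSucc c)) ((A.prod (C.powSucc c)).prod B) :=
    isIsogenous_prod_prod_swap_right A B (C.powSucc c)
  have h3 := nonempty_hodgeGroup_prod_mulEquiv_powSucc_prod_powSucc (A.prod (C.powSucc c)) B 0 b
  have h4 : AbelianVariety.IsIsogenous (((A.prod (C.powSucc c)).powSucc 0).prod (B.powSucc b)) ((A.prod (B.powSucc b)).prod (C.powSucc c)) :=
    isIsogenous_prod_prod_swap_right A (C.powSucc c) (B.powSucc b)
  have h5 : AbelianVariety.IsIsogenous ((A.prod (B.powSucc b)).prod (C.powSucc c)) (((B.powSucc b).prod (C.powSucc c)).prod A) :=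
    (isIsogenous_prod_assoc' A (B.powSucc b) (C.powSucc c)).trans (isIsogenous_prod_comm' A _)
  have h6 := nonempty_hodgeGroup_prod_mulEquiv_powSucc_prod_powSucc ((B.powSucc b).prod (C.powSucc c)) A 0 a
  have h7 : AbelianVariety.IsIsogenous ((((B.powSucc b).prod (C.powSucc c)).powSucc 0).prod (A.powSucc a))
      (((A.powSucc a).prod (B.powSucc b)).prod (C.powSucc c)) :=
    (isIsogenous_prod_comm' ((B.powSucc b).prod (C.powSucc c)) (A.powSucc a)).trans (isIsogenous_prod_assoc_symm (A.powSucc a) _ _)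
  exact nonempty_trans h1 (nonempty_trans (nonempty_hodgeGroup_mulEquiv_of_isIsogenous h2) (nonempty_trans h3
    (nonempty_trans (nonempty_hodgeGroup_mulEquiv_of_isIsogenous h4) (nonempty_trans (nonempty_hodgeGroup_mulEquiv_of_isIsogenous h5)
      (nonempty_trans h6 (nonempty_hodgeGroup_mulEquiv_of_isIsogenous h7))))))

/-- **`Hg((A^{a+1} × B^{b+1}) × C^{c+1})` is semisimple iff `Hg((A × B) × C)` is**, arbitrary `A`, `B`, `C`.
[cite: MoonenZarhin1999LowDim, §1] [cite: Gordon1999HodgeAVSurvey, 1.3 Definition] -/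
theorem hasSemisimpleHodgeGroup_powSucc_prod_powSucc_prod_powSucc_iff (A B C : AbelianVariety ℂ) (a b c : ℕ) :
    HasSemisimpleHodgeGroup (((A.powSucc a).prod (B.powSucc b)).prod (C.powSucc c)) ↔ HasSemisimpleHodgeGroup ((A.prod B).prod C) := by
  obtain ⟨e⟩ := nonempty_hodgeGroup_prod_prod_mulEquiv_powSucc_prod_powSucc_prod_powSucc A B C a b c
  exact (hasSemisimpleHodgeGroup_iff_of_mulEquiv e).symm

/-- `Hg(Y)(ℂ) ≅ Hg((A × B) × C)(ℂ)` for every `Y` isogenous to `(A^{a+1} × B^{b+1}) × C^{c+1}`, and the semisimplicity equivalence.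
[cite: MoonenZarhin1999LowDim, §1] [cite: Gordon1999HodgeAVSurvey, 1.3 Definition, 2.1.7 and 2.2] -/
theorem hasSemisimpleHodgeGroup_iff_of_isIsogenous_powSucc_prod_powSucc_prod_powSucc {A B C Y : AbelianVariety ℂ} {a b c : ℕ}
    (hY : AbelianVariety.IsIsogenous Y (((A.powSucc a).prod (B.powSucc b)).prod (C.powSucc c))) :
    HasSemisimpleHodgeGroup Y ↔ HasSemisimpleHodgeGroup ((A.prod B).prod C) := by
  obtain ⟨e₁⟩ := nonempty_hodgeGroup_mulEquiv_of_isIsogenous hY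
  obtain ⟨e₂⟩ := nonempty_hodgeGroup_prod_prod_mulEquiv_powSucc_prod_powSucc_prod_powSucc A B C a b c
  exact hasSemisimpleHodgeGroup_iff_of_mulEquiv (e₁.trans e₂.symm)

end ThreeFactors

end Literature.AlgebraicGeometry.Milne1999
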